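import Literature.AnabelianGeometry.EtaleTheta.Discharge.Sec3Thm37Standard
import Literature.AnabelianGeometry.EtaleTheta.FrdIVocabularyWeak
import HarnessLib

/-!
# [EtTh] Theorem 3.7 (ii), first clause: the non-dilating hypothesis read at the WEAK monoid vocabulary

Mochizuki, *The étale theta function …*, Publ. RIMS **45** (2009), Thm. 3.7 (ii), PDF p.79 (printed 305)
[cite: MochizukiEtTh2009, Thm 3.7 p.79]: "Suppose `D` is of FSMFF-type, and that `Φ` is non-dilating.
Then `C` is of standard type."

Weak-vocabulary twin of the last section of `Discharge/Sec3Thm37Standard.lean` (abc-iut-w4-d103 lineage),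
whose other theorems are already parametric in the [FrdI] vocabulary `V`: only the unfolding of the
non-dilating hypothesis was pinned to `treeMonoidVocab`.  Over abc-iut-L2-t3's `treeMonoidVocabWeak`
(`FrdIVocabularyWeak.lean`: same `IsNonDilating`, perf-factorial := `IsPerfFactorialCof` — the reading
needed at tempered coverings with infinitely many special-fibre components, abc-iut findings F-L2d2-1 /
F-L2d2-2) the same unfolding holds, so `isOfStandardType_iff` & co. apply verbatim to tempered Frobenioids
over the weak realified data (`ofRlfZWeak`, abc-iut-L6-t12).  Theorems only.  Seat abc-iut-L2-d2 (gen 3).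
HONEST FRAMING: nothing here bears on [IUTchIII] Cor. 3.12.
-/

namespace Literature.AnabelianGeometry.EtaleTheta

open CategoryTheory Opposite Literature.AlgebraicGeometry.Frobenioids

universe u₀ v₀ u v w

namespace TemperedFrobenioid

/-- At the WEAK monoid vocabulary `treeMonoidVocabWeak` ("non-dilating" = the tree's
`Frobenioids.IsNonDilating`, as for `treeMonoidVocab`), the hypothesis of abc-iut-L2-t3's `Thm37_ii` —
`∀ (A : Dᵒᵖ) (f : A ⟶ A), V.IsNonDilating (Φ(A)) (Φ.pull f)` — IS the tree's `IsNonDilatingOn Φ`.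
[cite: MochizukiEtTh2009, Thm 3.7 p.79] -/
theorem isNonDilatingOn_iff_pull_weak {D₀ : Type u₀} [Category.{v₀} D₀]
    {T' : RealifiedDivisorMonoids (D₀ := D₀) treeMonoidVocabWeak.{w}} {D : Type u} [Category.{v} D]
    {VD : FrdICatStub.{u, v, w} D} (C₀ : TemperedFrobenioid T' D VD) :
    IsNonDilatingOn C₀.divisorMonoid ↔
      ∀ (A : Dᵒᵖ) (f : A ⟶ A), treeMonoidVocabWeak.IsNonDilating (C₀.Φ.carrier A) (C₀.Φ.pull f) :=
  C₀.isNonDilatingOn_divisorMonoid_iff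

/-- **Thm 3.7 (ii), first clause, over the weak vocabulary**: for a tempered Frobenioid over realified data
typed with `treeMonoidVocabWeak`, if `D` is of FSMFF-type and `Φ` is non-dilating in the vocabulary's sense,
then — given the [FrdI] Thm 5.2 hypotheses on the model data — `C` is of standard type (the `V`-generic
`isOfStandardType_of` with the weak unfolding). [cite: MochizukiEtTh2009, Thm 3.7 p.79] -/
theorem isOfStandardType_of_weak {D₀ : Type u₀} [Category.{v₀} D₀]
    {T' : RealifiedDivisorMonoids (D₀ := D₀) treeMonoidVocabWeak.{w}} {D : Type u} [Category.{v} D]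
    {VD : FrdICatStub.{u, v, w} D} (C₀ : TemperedFrobenioid T' D VD)
    (hyp : ModelFrobenioid.Hypotheses C₀.divisorMonoid C₀.ratFnFunctor) (hD : IsOfFSMFFType D)
    (hnd : ∀ (A : Dᵒᵖ) (f : A ⟶ A), treeMonoidVocabWeak.IsNonDilating (C₀.Φ.carrier A) (C₀.Φ.pull f)) :
    (ModelFrobenioid.data C₀.divisorMonoid C₀.ratFnFunctor C₀.divBNatTrans).IsOfStandardType :=
  C₀.isOfStandardType_of hyp hD ((C₀.isNonDilatingOn_iff_pull_weak).2 hnd)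

end TemperedFrobenioid

end Literature.AnabelianGeometry.EtaleTheta
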